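import Literature.MathematicalPhysics.QuantumFieldTheory.Balaban1983to89.B3Ineq313Pointwise

/-!
# `Balaban1983to89.B3Ineq326Curly` — T. Bałaban, *(Higgs)₂,₃ quantum fields in a finite volume. III. Renormalization*,
Commun. Math. Phys. **88** (1983) 411–445 [Balaban1983Higgs3], p. 440 [PDF 30]: the LAST CURLY BRACKET of **(3.26)** (the four
vector self-energy graphs (3.25) after Taylor's formula (3.10)) *"can be analyzed as in (3.13), (3.14)"* — the (3.13)/(3.14)-type
POINTWISE estimate PROVED on the torus calculus from (2.10)-type kernel bounds

statement-level skeleton of published theorems with citation tags; proofs where landed; nothing here is a claim about the Yang–Mills mass gap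

PDF held: `paper:balaban1983-higgs-2-3-quantum-fields-finite-volume` (journal page = PDF page + 410).  Read: p. 440 [PDF 30] on the ×2
render `run/shared/lean/pub/pub-balaban/b2b-balaban-ref1/pages/1983-cmp88-higgs23-III/1983-cmp88-higgs23-III-p030-x2.png`; p. 436
[PDF 26] ((3.13)/(3.14)); p. 426 [PDF 16] ((2.10): *"each differentiation gives an additional factor (L^jη)^{−1}"*).

CITATION HEADER (lean-in-tree rule).  Part of the lit-balaban TYPED SKELETON (HOME `run/shared/lean/pub/lit-balaban/`), PHASE 2, seat p20
generation 3; companion of the seat's gen-2 files `B3Taylor310Remainder` ((3.10) remainder `remFwd`, Hölder bound `norm_remFwd_le`,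
(3.26) unconditional `eq326_taylor`) and `B3Ineq313Pointwise` ((3.13)/(3.14) pointwise for the scalar graph, `abs_term312_le`, and the
two printed mechanisms `exp_split_half`, `exp_mul_weight_le`).  WHAT IS REPRODUCED: row **B3.Eq3.25-3.32** of
`HOME/lit-balaban-r15/ROWS-B3.md` (fold owner r15), the p. 440 sentence on the last curly bracket of (3.26) (r15's `curly2`).

THE PRINTED TEXT (verbatim, p. 440, after the display (3.26) whose last curly bracket is
{Σ_{x,x′}η^{2d}Σ_{μ,μ′=1}^d g(x)A_μ(x) tr q²[−(G^η_{(j)}(0)∂^{η*}_{μ′})(x,x′)(G^η_{(j′)}(0)∂^{η*}_μ)(x′,x)|x′−x|^{1+α} + G^η_{(j)}(0;x,x′)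
(∂^η_{μ′}G^η_{(j′)}(0)∂^{η*}_μ)(x′,x)|x′−x|^{1+α}]·Σ_{b⊂Γ_{x,x′}}(η|b_−−x|^α/|x′−x|^{1+α})((∂^ηg′A′_{μ′})(b) − (∂^ηg′A′_{μ′})((b)_x))/|b_−−x|^α}):
*"where A, A′ are external vector field legs. The expressions in the last curly bracket above are the generalized expressions of the same
form as in (3.11), they have positive degree −d+3+α and can be analyzed as in (3.13), (3.14), and Proposition 2.2 can be applied."*
(3.13) p. 436: *"(the expression (3.12)) ≦ O(1)Σ_{Δ(v),Δ(v′)} sup_{x∈Δ(v)}|φ(x)|(L^{j₁}η)^{2d}(L^jη)^{−d}exp[−δ₀(L^jη)^{−1}dist(Δ(v),Δ(v′))]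
(L^{j′}η)^{−d+2}exp[−δ₀(L^{j′}η)^{−1}dist(Δ(v),Δ(v′))]·(L^{j₁}η)^{1+α} sup … |(∂^η_μφ′)(y) − (∂^η_μφ′)(x)|/|y−x|^α. (3.13) We can estimate the
factor ((L^{j₁}η)^{−1}dist(Δ(v),Δ(v′)))^{1+α} by O(1) using half of the exponential factor with index j₁."*

WHAT IS TYPED / PROVED, and how.  The last curly bracket is r15's `B3Sect3VectorSelfEnergy.curly2 η τ Gj Gj′ g A R` (τ = tr q², kernels
`kerA` = (G_{(j)}∂^{η*}_{μ′})(x,x′)(G_{(j′)}∂^{η*}_μ)(x′,x) and `kerB` = G_{(j)}(x,x′)(∂^η_{μ′}G_{(j′)}∂^{η*}_μ)(x′,x) over `dAdjKernel`/`d2Kernel`,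
combined kernel `kerC` = −kerA + kerB) with the (3.10) remainder of the leg functions g′A′_{μ′} (`R μ′ = remFwd η⁻¹ (legFn g′ A′ μ′)`, the
reading of `B3Taylor310Remainder.eq326_taylor`).  **`abs_curly2_le`** = "analyzed as in (3.13), (3.14)", POINTWISE form (before the
localization into cubes), PROVED: if the four kernels obey the (2.10)-type bounds at the scales `s = L^jη`, `s′ = L^{j′}η` with the printed
extra factor `s^{−1}` per differentiation — |(G_{(j)}∂^{η*}_{μ′})(x,x′)| ≤ C₁s^{1−d}e^{−δ|x−x′|/s}, |(G_{(j′)}∂^{η*}_μ)(x′,x)| ≤ C₂s′^{1−d}e^{−δ|x−x′|/s′},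
|G_{(j)}(x,x′)| ≤ C₃s^{2−d}e^{−δ|x−x′|/s}, |(∂^η_{μ′}G_{(j′)}∂^{η*}_μ)(x′,x)| ≤ C₄s′^{−d}e^{−δ|x−x′|/s′} —, |g| ≤ 1, and every leg function g′A′_{μ′}
satisfies the Hölder hypothesis `HolderDeriv η⁻¹ α H` of (3.13) (`0 ≤ α ≤ 1`), then
`|curly2| ≤ 2d|τ|H(2/δ + 8/δ²)(C₁C₂s^{1−d}s′^{1−d} + C₃C₄s^{2−d}s′^{−d})·(m·m^α)·Σ_{x,x′}η^{2d}(Σ_μ|A_μ(x)|)e^{−½δ|x−x′|/s}e^{−½δ|x−x′|/s′}`,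
`m = min(s,s′) = L^{j₁}η`: the printed factors of (3.13)/(3.14) — total kernel degree −2d+2 (split s^{1−d}s′^{1−d} resp. s^{2−d}s′^{−d} for the two
graphs of the bracket instead of (L^jη)^{−d}(L^{j′}η)^{−d+2} for (3.12)), the factor (L^{j₁}η)^{1+α} from the remainder (*"a differentiation of
the order 1+α"*, `norm_remFwd_le`) and *"half of the exponential factor with index j₁"* (`exp_mul_weight_le`), with the external vector leg
sup|A| in place of sup|φ|.  `abs_kerC_le` is the kernel-level bound.  The kernel bounds are HYPOTHESES (rows B3.Eq2.10–2.12, consequences of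
[Balaban1982Higgs1] Props. 2.1/2.3); the cube localization (row B3.Eq2.13-2.14) is not performed, as in `abs_term312_le`.  No file of another
seat is modified (imports only); theorems only.  Unit `lit-balaban-p20` (literature-prover-lit-balaban-p20-g3-0), 2026-08-21; HOME/FILED.md
records the proposal.
-/

open scoped BigOperators

namespace Literature.MathematicalPhysics.QuantumFieldTheory.Balaban1983to89.B3Ineq326Curly

open LatticeFieldCalculus B3Sect3ScalarSelfEnergy B3Sect3VectorSelfEnergy B3Taylor310Remainder B3Ineq313Pointwise

noncomputable section

variable {P : Params} {j : ℕ}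

/-- kernel: the combined kernel of the curly brackets of (3.26) under the (2.10)-type kernel bounds:
|tr q²[−(G_{(j)}∂^{η*}_{μ′})(x,x′)(G_{(j′)}∂^{η*}_μ)(x′,x) + G_{(j)}(x,x′)(∂^η_{μ′}G_{(j′)}∂^{η*}_μ)(x′,x)]| ≤ |tr q²|(C₁C₂s^{1−d}s′^{1−d} + C₃C₄s^{2−d}s′^{−d})
e^{−δ|x−x′|/s}e^{−δ|x−x′|/s′} (u = |x − x′| = η·`Site.tdist x x′`). [cite: Balaban1983Higgs3, (3.26) p.440] -/
theorem abs_kerC_le {η τ C₁ C₂ C₃ C₄ δ s s' : ℝ} {Gj Gj' : Kernel P j}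
    (hA : ∀ (μ' : Fin P.d) (x x' : Site P j),
      |dAdjKernel η⁻¹ μ' Gj x x'| ≤ C₁ * s ^ (1 - (P.d : ℝ)) * Real.exp (-(δ * s⁻¹ * (η * Site.tdist x x'))))
    (hA' : ∀ (μ : Fin P.d) (x x' : Site P j),
      |dAdjKernel η⁻¹ μ Gj' x' x| ≤ C₂ * s' ^ (1 - (P.d : ℝ)) * Real.exp (-(δ * s'⁻¹ * (η * Site.tdist x x'))))
    (hB : ∀ x x' : Site P j, |Gj x x'| ≤ C₃ * s ^ (2 - (P.d : ℝ)) * Real.exp (-(δ * s⁻¹ * (η * Site.tdist x x'))))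
    (hB' : ∀ (μ μ' : Fin P.d) (x x' : Site P j),
      |d2Kernel η⁻¹ μ' μ Gj' x' x| ≤ C₄ * s' ^ (-(P.d : ℝ)) * Real.exp (-(δ * s'⁻¹ * (η * Site.tdist x x'))))
    (μ μ' : Fin P.d) (x x' : Site P j) :
    |kerC η τ Gj Gj' μ μ' x x'| ≤
      |τ| * (C₁ * C₂ * (s ^ (1 - (P.d : ℝ)) * s' ^ (1 - (P.d : ℝ))) + C₃ * C₄ * (s ^ (2 - (P.d : ℝ)) * s' ^ (-(P.d : ℝ)))) *
        (Real.exp (-(δ * s⁻¹ * (η * Site.tdist x x'))) * Real.exp (-(δ * s'⁻¹ * (η * Site.tdist x x')))) := by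
  set u : ℝ := η * Site.tdist x x' with hu
  have h1 := hA μ' x x'
  have h2 := hA' μ x x'
  have h3 := hB x x'
  have h4 := hB' μ μ' x x'
  have hp1 : 0 ≤ C₁ * s ^ (1 - (P.d : ℝ)) * Real.exp (-(δ * s⁻¹ * u)) := (abs_nonneg _).trans h1
  have hp3 : 0 ≤ C₃ * s ^ (2 - (P.d : ℝ)) * Real.exp (-(δ * s⁻¹ * u)) := (abs_nonneg _).trans h3
  have hkA : |kerA η τ Gj Gj' μ μ' x x'| ≤ |τ| * ((C₁ * s ^ (1 - (P.d : ℝ)) * Real.exp (-(δ * s⁻¹ * u))) *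
      (C₂ * s' ^ (1 - (P.d : ℝ)) * Real.exp (-(δ * s'⁻¹ * u)))) := by
    unfold kerA
    rw [abs_mul, abs_mul]
    exact mul_le_mul_of_nonneg_left (mul_le_mul h1 h2 (abs_nonneg _) hp1) (abs_nonneg _)
  have hkB : |kerB η τ Gj Gj' μ μ' x x'| ≤ |τ| * ((C₃ * s ^ (2 - (P.d : ℝ)) * Real.exp (-(δ * s⁻¹ * u))) *
      (C₄ * s' ^ (-(P.d : ℝ)) * Real.exp (-(δ * s'⁻¹ * u)))) := by
    unfold kerB
    rw [abs_mul, abs_mul]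
    exact mul_le_mul_of_nonneg_left (mul_le_mul h3 h4 (abs_nonneg _) hp3) (abs_nonneg _)
  unfold kerC
  calc |-kerA η τ Gj Gj' μ μ' x x' + kerB η τ Gj Gj' μ μ' x x'|
      ≤ |-kerA η τ Gj Gj' μ μ' x x'| + |kerB η τ Gj Gj' μ μ' x x'| := abs_add_le _ _
    _ = |kerA η τ Gj Gj' μ μ' x x'| + |kerB η τ Gj Gj' μ μ' x x'| := by rw [abs_neg]
    _ ≤ |τ| * ((C₁ * s ^ (1 - (P.d : ℝ)) * Real.exp (-(δ * s⁻¹ * u))) * (C₂ * s' ^ (1 - (P.d : ℝ)) * Real.exp (-(δ * s'⁻¹ * u))))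
        + |τ| * ((C₃ * s ^ (2 - (P.d : ℝ)) * Real.exp (-(δ * s⁻¹ * u))) * (C₄ * s' ^ (-(P.d : ℝ)) * Real.exp (-(δ * s'⁻¹ * u)))) :=
        add_le_add hkA hkB
    _ = _ := by ring

/-- **p. 440 [PDF 30] of [Balaban1983Higgs3]** — *"The expressions in the last curly bracket above [of (3.26)] are the generalized expressions
of the same form as in (3.11), they have positive degree −d+3+α and can be analyzed as in (3.13), (3.14)"* — the (3.13)/(3.14)-type bound in
POINTWISE form, PROVED: under the (2.10)-type kernel bounds on the four kernels of the bracket at the scales `s = L^jη`, `s′ = L^{j′}η`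
(degrees −d+1, −d+1 resp. −d+2, −d), `|g| ≤ 1` and the Hölder hypothesis `‖∂^η_ν(g′A′_{μ′})(z) − ∂^η_ν(g′A′_{μ′})(z′)‖ ≤ H|z − z′|^α` for
every leg function (`0 ≤ α ≤ 1`), the last curly bracket `curly2` of (3.26) with the (3.10) remainder `remFwd` of the legs satisfies
`|curly2| ≤ 2d|τ|H(2/δ + 8/δ²)(C₁C₂s^{1−d}s′^{1−d} + C₃C₄s^{2−d}s′^{−d})·(m·m^α)·Σ_{x,x′}η^{2d}(Σ_μ|A_μ(x)|)e^{−½δ|x−x′|/s}e^{−½δ|x−x′|/s′}`,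
`m = min(s,s′) = L^{j₁}η` — the printed factors of (3.13): the kernel factors with *"half of the exponential factor"* (δ₀ = ½δ), the factor
(L^{j₁}η)^{1+α} (`m·m^α`) of *"a differentiation of the order 1+α"* acting on the leg, and the external leg; summing `Σ_{x∈Δ(v),x′∈Δ(v′)}
η^{2d} = (L^{j₁}η)^{2d}` with suprema over the cubes gives the displayed shape of (3.13). [cite: Balaban1983Higgs3, (3.26) p.440] -/
theorem abs_curly2_le (η : ℝ) (hη : 0 < η) {α H τ C₁ C₂ C₃ C₄ δ s s' : ℝ} (hα0 : 0 ≤ α) (hα1 : α ≤ 1) (hH : 0 ≤ H)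
    (hδ : 0 < δ) (hs : 0 < s) (hs' : 0 < s') (Gj Gj' : Kernel P j) (g : SiteField P j ℝ) (hg : ∀ x, |g x| ≤ 1)
    (A : VecField P j ℝ) (g' : SiteField P j ℝ) (A' : VecField P j ℝ)
    (hA : ∀ (μ' : Fin P.d) (x x' : Site P j),
      |dAdjKernel η⁻¹ μ' Gj x x'| ≤ C₁ * s ^ (1 - (P.d : ℝ)) * Real.exp (-(δ * s⁻¹ * (η * Site.tdist x x'))))
    (hA' : ∀ (μ : Fin P.d) (x x' : Site P j),
      |dAdjKernel η⁻¹ μ Gj' x' x| ≤ C₂ * s' ^ (1 - (P.d : ℝ)) * Real.exp (-(δ * s'⁻¹ * (η * Site.tdist x x'))))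
    (hB : ∀ x x' : Site P j, |Gj x x'| ≤ C₃ * s ^ (2 - (P.d : ℝ)) * Real.exp (-(δ * s⁻¹ * (η * Site.tdist x x'))))
    (hB' : ∀ (μ μ' : Fin P.d) (x x' : Site P j),
      |d2Kernel η⁻¹ μ' μ Gj' x' x| ≤ C₄ * s' ^ (-(P.d : ℝ)) * Real.exp (-(δ * s'⁻¹ * (η * Site.tdist x x'))))
    (hφ' : ∀ μ' : Fin P.d, HolderDeriv η⁻¹ α H (legFn g' A' μ')) :
    |curly2 η τ Gj Gj' g A (fun μ' x x' => remFwd η⁻¹ (legFn g' A' μ') x x')| ≤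
      2 * P.d * |τ| * H * (2 / δ + 8 / δ ^ 2) *
        (C₁ * C₂ * (s ^ (1 - (P.d : ℝ)) * s' ^ (1 - (P.d : ℝ))) + C₃ * C₄ * (s ^ (2 - (P.d : ℝ)) * s' ^ (-(P.d : ℝ)))) *
        (min s s' * (min s s') ^ α) *
        ∑ x : Site P j, ∑ x' : Site P j, η ^ (2 * P.d) *
          ((∑ μ : Fin P.d, |A ⟨x, μ⟩|) * (Real.exp (-(δ / 2 * s⁻¹ * (η * Site.tdist x x'))) *
            Real.exp (-(δ / 2 * s'⁻¹ * (η * Site.tdist x x'))))) := by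
  -- the kernel constant (nonnegative, as forced by the hypotheses)
  set Kc : ℝ := |τ| * (C₁ * C₂ * (s ^ (1 - (P.d : ℝ)) * s' ^ (1 - (P.d : ℝ))) +
    C₃ * C₄ * (s ^ (2 - (P.d : ℝ)) * s' ^ (-(P.d : ℝ)))) with hKc
  have hKc0 : 0 ≤ Kc := by
    have h := (abs_nonneg _).trans (abs_kerC_le (τ := τ) hA hA' hB hB' ⟨0, P.hd⟩ ⟨0, P.hd⟩ default default)
    have hpos : 0 < Real.exp (-(δ * s⁻¹ * (η * Site.tdist (default : Site P j) default))) *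
        Real.exp (-(δ * s'⁻¹ * (η * Site.tdist (default : Site P j) default))) := mul_pos (Real.exp_pos _) (Real.exp_pos _)
    exact nonneg_of_mul_nonneg_left h hpos
  -- the full constant
  set K : ℝ := 2 * P.d * |τ| * H * (2 / δ + 8 / δ ^ 2) *
    (C₁ * C₂ * (s ^ (1 - (P.d : ℝ)) * s' ^ (1 - (P.d : ℝ))) + C₃ * C₄ * (s ^ (2 - (P.d : ℝ)) * s' ^ (-(P.d : ℝ)))) *
    (min s s' * (min s s') ^ α) with hK
  -- the bound per (x, x′, μ, μ′)
  have hterm : ∀ (x x' : Site P j) (μ μ' : Fin P.d),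
      |g x * A ⟨x, μ⟩ * kerC η τ Gj Gj' μ μ' x x' * remFwd η⁻¹ (legFn g' A' μ') x x'| ≤
        |A ⟨x, μ⟩| * (Kc * (2 * H) * ((2 / δ + 8 / δ ^ 2) * (min s s' * (min s s') ^ α) *
          (Real.exp (-(δ / 2 * s⁻¹ * (η * Site.tdist x x'))) * Real.exp (-(δ / 2 * s'⁻¹ * (η * Site.tdist x x')))))) := by
    intro x x' μ μ'
    set u : ℝ := η * Site.tdist x x' with hu
    have hu0 : 0 ≤ u := mul_nonneg hη.le (Nat.cast_nonneg _)
    -- the remainder: a differentiation of order 1 + α acting on the leg g′A′_{μ′}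
    have hR : |remFwd η⁻¹ (legFn g' A' μ') x x'| ≤ 2 * H * u * u ^ α := by
      have h := norm_remFwd_le (inv_pos.mpr hη) hα0 hH (hφ' μ') x x'
      rw [inv_inv, Real.norm_eq_abs] at h
      exact h
    have hk := abs_kerC_le (τ := τ) hA hA' hB hB' μ μ' x x'
    have hweight := exp_mul_weight_le hδ hs hs' hu0 hα0 hα1
    have hgx := hg x
    calc |g x * A ⟨x, μ⟩ * kerC η τ Gj Gj' μ μ' x x' * remFwd η⁻¹ (legFn g' A' μ') x x'|
        = |g x| * |A ⟨x, μ⟩| * |kerC η τ Gj Gj' μ μ' x x'| * |remFwd η⁻¹ (legFn g' A' μ') x x'| := by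
          rw [abs_mul, abs_mul, abs_mul]
      _ ≤ 1 * |A ⟨x, μ⟩| * (Kc * (Real.exp (-(δ * s⁻¹ * u)) * Real.exp (-(δ * s'⁻¹ * u)))) * (2 * H * u * u ^ α) := by
          gcongr
      _ = |A ⟨x, μ⟩| * (Kc * (2 * H)) * (Real.exp (-(δ * s⁻¹ * u)) * Real.exp (-(δ * s'⁻¹ * u)) * (u * u ^ α)) := by ring
      _ ≤ |A ⟨x, μ⟩| * (Kc * (2 * H)) * ((2 / δ + 8 / δ ^ 2) * (min s s' * (min s s') ^ α) *
          (Real.exp (-(δ / 2 * s⁻¹ * u)) * Real.exp (-(δ / 2 * s'⁻¹ * u)))) :=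
          mul_le_mul_of_nonneg_left hweight (by positivity)
      _ = _ := by ring
  -- summation over μ, μ′ at fixed (x, x′)
  have hinner : ∀ x x' : Site P j,
      |η ^ (2 * P.d) * ∑ μ : Fin P.d, ∑ μ' : Fin P.d,
          g x * A ⟨x, μ⟩ * kerC η τ Gj Gj' μ μ' x x' * remFwd η⁻¹ (legFn g' A' μ') x x'| ≤
        K * (η ^ (2 * P.d) * ((∑ μ : Fin P.d, |A ⟨x, μ⟩|) *
          (Real.exp (-(δ / 2 * s⁻¹ * (η * Site.tdist x x'))) * Real.exp (-(δ / 2 * s'⁻¹ * (η * Site.tdist x x')))))) := by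
    intro x x'
    set E : ℝ := Real.exp (-(δ / 2 * s⁻¹ * (η * Site.tdist x x'))) * Real.exp (-(δ / 2 * s'⁻¹ * (η * Site.tdist x x')))
      with hE
    rw [abs_mul, abs_of_nonneg (by positivity : (0 : ℝ) ≤ η ^ (2 * P.d))]
    have hsum : |∑ μ : Fin P.d, ∑ μ' : Fin P.d,
          g x * A ⟨x, μ⟩ * kerC η τ Gj Gj' μ μ' x x' * remFwd η⁻¹ (legFn g' A' μ') x x'| ≤
        ∑ μ : Fin P.d, ∑ _μ' : Fin P.d, |A ⟨x, μ⟩| * (Kc * (2 * H) * ((2 / δ + 8 / δ ^ 2) * (min s s' * (min s s') ^ α) * E)) := by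
      refine (Finset.abs_sum_le_sum_abs _ _).trans (Finset.sum_le_sum fun μ _ => ?_)
      exact (Finset.abs_sum_le_sum_abs _ _).trans (Finset.sum_le_sum fun μ' _ => hterm x x' μ μ')
    have hconst : ∑ μ : Fin P.d, ∑ _μ' : Fin P.d, |A ⟨x, μ⟩| * (Kc * (2 * H) * ((2 / δ + 8 / δ ^ 2) * (min s s' * (min s s') ^ α) * E))
        = P.d * (Kc * (2 * H) * ((2 / δ + 8 / δ ^ 2) * (min s s' * (min s s') ^ α))) * ((∑ μ : Fin P.d, |A ⟨x, μ⟩|) * E) := by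
      simp only [Finset.sum_const, Finset.card_univ, Fintype.card_fin, nsmul_eq_mul, Finset.sum_mul, Finset.mul_sum]
      exact Finset.sum_congr rfl fun μ _ => by ring
    calc η ^ (2 * P.d) * |∑ μ : Fin P.d, ∑ μ' : Fin P.d,
            g x * A ⟨x, μ⟩ * kerC η τ Gj Gj' μ μ' x x' * remFwd η⁻¹ (legFn g' A' μ') x x'|
        ≤ η ^ (2 * P.d) * (P.d * (Kc * (2 * H) * ((2 / δ + 8 / δ ^ 2) * (min s s' * (min s s') ^ α))) *
            ((∑ μ : Fin P.d, |A ⟨x, μ⟩|) * E)) := by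
          rw [← hconst]
          exact mul_le_mul_of_nonneg_left hsum (by positivity)
      _ = K * (η ^ (2 * P.d) * ((∑ μ : Fin P.d, |A ⟨x, μ⟩|) * E)) := by rw [hK, hKc]; ring
  -- summation over x, x′
  unfold curly2 pairSum
  calc |∑ x : Site P j, ∑ x' : Site P j, η ^ (2 * P.d) * ∑ μ : Fin P.d, ∑ μ' : Fin P.d,
          g x * A ⟨x, μ⟩ * kerC η τ Gj Gj' μ μ' x x' * remFwd η⁻¹ (legFn g' A' μ') x x'|
      ≤ ∑ x : Site P j, |∑ x' : Site P j, η ^ (2 * P.d) * ∑ μ : Fin P.d, ∑ μ' : Fin P.d,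
          g x * A ⟨x, μ⟩ * kerC η τ Gj Gj' μ μ' x x' * remFwd η⁻¹ (legFn g' A' μ') x x'| := Finset.abs_sum_le_sum_abs _ _
    _ ≤ ∑ x : Site P j, ∑ x' : Site P j, |η ^ (2 * P.d) * ∑ μ : Fin P.d, ∑ μ' : Fin P.d,
          g x * A ⟨x, μ⟩ * kerC η τ Gj Gj' μ μ' x x' * remFwd η⁻¹ (legFn g' A' μ') x x'| :=
        Finset.sum_le_sum fun x _ => Finset.abs_sum_le_sum_abs _ _
    _ ≤ ∑ x : Site P j, ∑ x' : Site P j, K * (η ^ (2 * P.d) * ((∑ μ : Fin P.d, |A ⟨x, μ⟩|) *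
          (Real.exp (-(δ / 2 * s⁻¹ * (η * Site.tdist x x'))) * Real.exp (-(δ / 2 * s'⁻¹ * (η * Site.tdist x x')))))) :=
        Finset.sum_le_sum fun x _ => Finset.sum_le_sum fun x' _ => hinner x x'
    _ = K * ∑ x : Site P j, ∑ x' : Site P j, η ^ (2 * P.d) * ((∑ μ : Fin P.d, |A ⟨x, μ⟩|) *
          (Real.exp (-(δ / 2 * s⁻¹ * (η * Site.tdist x x'))) * Real.exp (-(δ / 2 * s'⁻¹ * (η * Site.tdist x x'))))) := by
        rw [Finset.mul_sum]
        exact Finset.sum_congr rfl fun x _ => by rw [Finset.mul_sum]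

end

end Literature.MathematicalPhysics.QuantumFieldTheory.Balaban1983to89.B3Ineq326Curly
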